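import Literature.AlgebraicGeometry.HodgeTheory.VHSDataSubHodgeStructureTranslateLocusExteriorPower
import Literature.AlgebraicGeometry.HodgeTheory.VHSDataHodgeClassesAlongPathsTensorConstructions
import HarnessLib

/-!
# Sub-Hodge structures along paths (Cattani–Deligne–Kaplan, Cor. 1.4, generic form): a rational subspace `U ⊆ V_s` all of whose flat translates are
# sub-Hodge structures ⟺ its integral `d`-vector `m₁ ∧ ⋯ ∧ m_d` is a GENERIC Hodge class of `⋀ᵈ D`; outside the exceptional Hodge locus of `⋀ᵈ D`
# (for lines: at every Hodge-generic point of `D`) EVERY sub-Hodge structure of `V_s` is generic; the points carrying a non-generic sub-Hodge structure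
# lie in the exceptional locus of `⋀ᵈ D` (for lines: ARE the exceptional locus of `D`), hence are countably many with dense complement on a charted curve

Topic `Literature/AlgebraicGeometry/HodgeTheory` (namespace `Literature.AlgebraicGeometry.Motives.VHSData`), lane `lit-hodgefound` (seat `p08`, row g61-#16);
the JUNCTION of the tree's Cor. 1.4 files (`VHSDataSubHodgeStructureTranslateLocus[ExteriorPower]`: a flat translate `γ · U` underlies a sub-Hodge structure
iff the determination `γ · (m₁ ∧ ⋯ ∧ m_d)` in `⋀ᵈ D` is of type `(P,P)`, `2P = d·k`; for a line `ℚ · u₀` iff `γ · u₀` is of type `(p,p)`) with the series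
«Hodge classes along paths» (`VHSDataHodgeClassesAlongPaths`: `IsHodgeAlong`, `exceptionalHodgeLocus`, chart countability;
`VHSDataHodgeClassesAlongPathsTensorConstructions`: `hodgeGenericLocus ⊆ (exceptionalHodgeLocus D p)ᶜ`).  THEOREMS ONLY — no definition, no named fact,
no instance (D-0026 net debt `0`).

PRINTED SOURCE, VERBATIM (E. Cattani, P. Deligne, A. Kaplan, *On the locus of Hodge classes*, J. Amer. Math. Soc. 8 (1995), p. 486; held text
`paper:arxiv-alg-geom_9402009` p0002).  «**Corollary 1.4.** Let `𝒱` be a polarizable variation of Hodge structures on `S`, fix `s ∈ S` and let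
`U_ℚ ⊂ (𝒱_s)_ℚ` be a rational subspace. The locus where some flat translate of `U_ℚ` is a Hodge substructure is an algebraic subvariety of `S`. … A subspace
`U_ℚ ⊂ H_ℚ` is a sub-Hodge structure … if and only if `U_ℝ` is stable under `ℂ*`. This amounts to … `⋀ⁿ U_ℚ` being a Hodge substructure of `⋀ⁿ H_ℚ`, and
reduces us to the one-dimensional case.»  C. Voisin, *Hodge Theory II*, §5.3.3 (very general points: Hodge classes — here sub-Hodge structures, through
`⋀ᵈ` — are flat); M. Green, P. Griffiths, M. Kerr (2012), Ch. III (III.2) (at a Hodge-generic point the Hodge tensors are those invariant under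
continuation).

CONTENT (`D : VHSData S k`; `m : Fin d → V_ℤ,s` an integral frame, `toRat ∘ m` linearly independent; `P + P = d·k`).
* §0 `isHodgeAlong_univ_iff_forall_quotient` (genericity quantified over path CLASSES).
* §1 **`forall_exists_subHodgeStructure_translate_iff_isHodgeAlong_univ_exteriorPower`** — ALL flat translates of `span(toRat mᵢ)` along ALL paths are
  sub-Hodge structures **iff** `m₁ ∧ ⋯ ∧ m_d` is a GENERIC class of `⋀ᵈ D` of level `P`; the `W`-local form; the form for a given `U` of dimension `d`.
* §2 **`forall_exists_subHodgeStructure_translate_of_not_mem_exceptionalHodgeLocus_exteriorPower`** — at a point OUTSIDE the exceptional Hodge locus of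
  `⋀ᵈ D` in level `P`, EVERY `d`-dimensional sub-Hodge structure `U ⊆ V_s` is generic (all its flat translates are sub-Hodge structures);
  **`setOf_exists_nonGeneric_subHodgeStructure_subset_exceptionalHodgeLocus_exteriorPower`** — the points carrying a NON-generic `d`-dimensional sub-Hodge
  structure lie in `exceptionalHodgeLocus (⋀ᵈ D) P`; hence (`IsLocallyFlatCharted.countable_and_dense_compl_setOf_exists_nonGeneric_subHodgeStructure`) they
  are COUNTABLY many with dense complement on a Lindelöf base flat-charted for `⋀ᵈ D`.
* §3 LINES through `D` itself (`2p = k`, `u₀ ≠ 0` integral): **`forall_exists_subHodgeStructure_translate_line_iff_isHodgeAlong_univ`**;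
  **`forall_exists_subHodgeStructure_translate_line_of_mem_hodgeGenericLocus`** (at a HODGE-GENERIC point every rank-one sub-Hodge structure is
  generic); **`setOf_exists_nonGeneric_line_eq_exceptionalHodgeLocus`** (the points carrying a non-generic LINE sub-Hodge structure ARE the exceptional
  Hodge locus of level `p`); `hodgeGenericLocus_subset_compl_setOf_exists_nonGeneric_line`.

HONEST SCOPE.  Hypothesis structure `VHSData` (no holomorphy); the general-`d` statements go through the exterior-power datum `⋀ᵈ D` of the tree and its
own exceptional locus ∕ charts (the tree has no morphism `⋀ᵈ D → D^{⊗d}`, so `hodgeGenericLocus D` is related to sub-Hodge structures only for lines).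

## References

* [CattaniDeligneKaplan1995] E. Cattani, P. Deligne, A. Kaplan, *On the locus of Hodge classes*, J. Amer. Math. Soc. 8 (1995) 483–506, Cor. 1.3, Cor. 1.4
  and its proof (p. 486).
* [VoisinHodgeII2003] C. Voisin, *Hodge Theory and Complex Algebraic Geometry II*, CUP (2003), §5.3.1, §5.3.3.
* [GreenGriffithsKerr2012] M. Green, P. Griffiths, M. Kerr, *Mumford–Tate Groups and Domains*, Ann. of Math. Studies 183 (2012), Ch. III, (III.2).
* [Deligne1970] P. Deligne, *Équations différentielles à points singuliers réguliers*, LNM 163 (1970), I.1.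
-/

noncomputable section

open _root_.Topology _root_.Filter Set

namespace Literature.AlgebraicGeometry

open Motives Motives.HodgeStructure HodgeTheory Topology

namespace Motives.VHSData

variable {S : Type} [TopologicalSpace S] {k : ℤ} (D : VHSData S k)

/-! ## §0 Genericity over path classes -/

/-- `u` is generic iff EVERY determination along every path CLASS is of type `(p,p)`. [cite: CattaniDeligneKaplan1995, Cor. 1.3 (p. 484)] [cite: Deligne1970, I.1] -/
theorem isHodgeAlong_univ_iff_forall_quotient {p : ℤ} {s : S} (u : D.VZ.fiber s) :
    D.IsHodgeAlong p u univ ↔ ∀ (t : S) (γ : Path.Homotopic.Quotient s t), D.IsHodgeAt t p (D.VZ.transport γ u) := by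
  rw [isHodgeAlong_univ_iff]
  refine ⟨fun h t γ => ?_, fun h t γ => h t _⟩
  induction γ using Path.Homotopic.Quotient.ind with | mk γ => exact h γ

/-! ## §1 Generic sub-Hodge structures = generic wedge classes -/

section Frame

variable {s : S} {d : ℕ} {m : Fin d → D.VZ.fiber s} {P : ℤ}

/-- **Cor. 1.4 ALONG ALL PATHS**: all flat translates of `span(toRat mᵢ)` along all paths are sub-Hodge structures **iff** the integral `d`-vector
`m₁ ∧ ⋯ ∧ m_d` is a GENERIC Hodge class of `⋀ᵈ D` of level `P` (`2P = d·k`). [cite: CattaniDeligneKaplan1995, proof of Cor. 1.4 (p. 486) and Cor. 1.3 (p. 484)] -/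
theorem forall_exists_subHodgeStructure_translate_iff_isHodgeAlong_univ_exteriorPower (hu : LinearIndependent ℚ (fun i => D.toRat s (m i)))
    (hP : P + P = d * k) :
    (∀ (t : S) (γ : Path.Homotopic.Quotient s t), ∃ W : SubHodgeStructure (D.hodge t),
        W.toSubmodule = (Submodule.span ℚ (Set.range fun i => D.toRat s (m i))).map (D.V.transport γ)) ↔
      (D.exteriorPower d).IsHodgeAlong P (_root_.exteriorPower.ιMulti ℤ d m) univ := by
  rw [isHodgeAlong_univ_iff_forall_quotient]
  exact forall_congr' fun t => forall_congr' fun γ => D.exists_subHodgeStructure_translate_iff_isHodgeAt_exteriorPower γ hu hP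

/-- The `W`-local form: translates along paths INSIDE `W`. [cite: CattaniDeligneKaplan1995, proof of Cor. 1.4 (p. 486)] -/
theorem forall_exists_subHodgeStructure_translate_iff_isHodgeAlong_exteriorPower (hu : LinearIndependent ℚ (fun i => D.toRat s (m i)))
    (hP : P + P = d * k) (W : Set S) :
    (∀ ⦃t : S⦄ (γ : Path s t), (∀ τ, γ τ ∈ W) → ∃ W' : SubHodgeStructure (D.hodge t),
        W'.toSubmodule = (Submodule.span ℚ (Set.range fun i => D.toRat s (m i))).map (D.V.transport (Path.Homotopic.Quotient.mk γ))) ↔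
      (D.exteriorPower d).IsHodgeAlong P (_root_.exteriorPower.ιMulti ℤ d m) W :=
  ⟨fun h _ γ hγ => (D.exists_subHodgeStructure_translate_iff_isHodgeAt_exteriorPower _ hu hP).1 (h γ hγ),
    fun h _ γ hγ => (D.exists_subHodgeStructure_translate_iff_isHodgeAt_exteriorPower _ hu hP).2 (h γ hγ)⟩

/-- The form for a given `U ⊆ V_s` of dimension `d` containing the frame. [cite: CattaniDeligneKaplan1995, proof of Cor. 1.4 (p. 486)] -/
theorem forall_exists_subHodgeStructure_translate_iff_isHodgeAlong_univ_exteriorPower_of_finrank_eq {U : Submodule ℚ (D.V.fiber s)}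
    (hu : LinearIndependent ℚ (fun i => D.toRat s (m i))) (hmU : ∀ i, D.toRat s (m i) ∈ U) (hd : Module.finrank ℚ U = d) (hP : P + P = d * k) :
    (∀ (t : S) (γ : Path.Homotopic.Quotient s t), ∃ W : SubHodgeStructure (D.hodge t), W.toSubmodule = U.map (D.V.transport γ)) ↔
      (D.exteriorPower d).IsHodgeAlong P (_root_.exteriorPower.ιMulti ℤ d m) univ := by
  rw [isHodgeAlong_univ_iff_forall_quotient]
  exact forall_congr' fun t => forall_congr' fun γ => D.exists_subHodgeStructure_translate_iff_isHodgeAt_exteriorPower_of_finrank_eq γ hu hmU hd hP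

end Frame

/-! ## §2 Outside the exceptional locus of `⋀ᵈ D` every sub-Hodge structure is generic -/

/-- **AT A POINT OUTSIDE THE EXCEPTIONAL HODGE LOCUS OF `⋀ᵈ D` (level `P`, `2P = d·k`) EVERY `d`-DIMENSIONAL SUB-HODGE STRUCTURE `U ⊆ V_s` IS GENERIC**:
all its flat translates along all paths are sub-Hodge structures (its integral `d`-vector is of type `(P,P)` at `s`, hence generic).
[cite: CattaniDeligneKaplan1995, proof of Cor. 1.4 (p. 486)] [cite: VoisinHodgeII2003, §5.3.3] -/
theorem forall_exists_subHodgeStructure_translate_of_not_mem_exceptionalHodgeLocus_exteriorPower {s : S} {d : ℕ} {P : ℤ} (hP : P + P = d * k)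
    (hs : s ∉ (D.exteriorPower d).exceptionalHodgeLocus P) {U : Submodule ℚ (D.V.fiber s)} (hd : Module.finrank ℚ U = d)
    (hU : ∃ W : SubHodgeStructure (D.hodge s), W.toSubmodule = U) (t : S) (γ : Path.Homotopic.Quotient s t) :
    ∃ W : SubHodgeStructure (D.hodge t), W.toSubmodule = U.map (D.V.transport γ) := by
  obtain ⟨m, hu, hmU⟩ := D.exists_integral_frame s hd
  have h0 : (D.exteriorPower d).IsHodgeAt s P (_root_.exteriorPower.ιMulti ℤ d m) := by
    have h := (D.exists_subHodgeStructure_translate_iff_isHodgeAt_exteriorPower_of_finrank_eq (Path.Homotopic.Quotient.refl s) hu hmU hd hP).1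
      (by rwa [LocalSystem.transport_refl, Submodule.map_id])
    rwa [LocalSystem.transport_refl, LinearMap.id_apply] at h
  have hgen : (D.exteriorPower d).IsHodgeAlong P (_root_.exteriorPower.ιMulti ℤ d m) univ := by
    by_contra hnot
    exact hs ⟨_, h0, hnot⟩
  exact (D.forall_exists_subHodgeStructure_translate_iff_isHodgeAlong_univ_exteriorPower_of_finrank_eq hu hmU hd hP).2 hgen t γ

/-- **THE POINTS CARRYING A NON-GENERIC `d`-DIMENSIONAL SUB-HODGE STRUCTURE LIE IN THE EXCEPTIONAL HODGE LOCUS OF `⋀ᵈ D`** (level `P`, `2P = d·k`).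
[cite: CattaniDeligneKaplan1995, proof of Cor. 1.4 (p. 486) and Cor. 1.3 (p. 484)] [cite: VoisinHodgeII2003, §5.3.3] -/
theorem setOf_exists_nonGeneric_subHodgeStructure_subset_exceptionalHodgeLocus_exteriorPower (d : ℕ) {P : ℤ} (hP : P + P = d * k) :
    {s : S | ∃ U : Submodule ℚ (D.V.fiber s), Module.finrank ℚ U = d ∧ (∃ W : SubHodgeStructure (D.hodge s), W.toSubmodule = U) ∧
        ∃ (t : S) (γ : Path.Homotopic.Quotient s t), ¬ ∃ W : SubHodgeStructure (D.hodge t), W.toSubmodule = U.map (D.V.transport γ)} ⊆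
      (D.exteriorPower d).exceptionalHodgeLocus P := by
  rintro s ⟨U, hd, hU, t, γ, hnot⟩
  by_contra hs
  exact hnot (D.forall_exists_subHodgeStructure_translate_of_not_mem_exceptionalHodgeLocus_exteriorPower hP hs hd hU t γ)

section Charted

variable {α ι : Type*} {ψ : α → OpenPartialHomeomorph S ℂ} {σ : ι → ℂ → S}

/-- **On a Lindelöf base FLAT-CHARTED FOR `⋀ᵈ D` the points carrying a non-generic `d`-dimensional sub-Hodge structure are COUNTABLY MANY and their
complement is DENSE.** [cite: CattaniDeligneKaplan1995, Cor. 1.4 and its proof (p. 486), Cor. 1.2 (p. 484)] [cite: VoisinHodgeII2003, §5.3.3] -/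
theorem IsLocallyFlatCharted.countable_and_dense_compl_setOf_exists_nonGeneric_subHodgeStructure [LindelofSpace S] {d : ℕ}
    (h : (D.exteriorPower d).IsLocallyFlatCharted ψ σ) (hcov : ∀ x : S, ∃ a, x ∈ (ψ a).source) {P : ℤ} (hP : P + P = d * k) :
    {s : S | ∃ U : Submodule ℚ (D.V.fiber s), Module.finrank ℚ U = d ∧ (∃ W : SubHodgeStructure (D.hodge s), W.toSubmodule = U) ∧
        ∃ (t : S) (γ : Path.Homotopic.Quotient s t), ¬ ∃ W : SubHodgeStructure (D.hodge t), W.toSubmodule = U.map (D.V.transport γ)}.Countable ∧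
      Dense {s : S | ∃ U : Submodule ℚ (D.V.fiber s), Module.finrank ℚ U = d ∧ (∃ W : SubHodgeStructure (D.hodge s), W.toSubmodule = U) ∧
        ∃ (t : S) (γ : Path.Homotopic.Quotient s t), ¬ ∃ W : SubHodgeStructure (D.hodge t), W.toSubmodule = U.map (D.V.transport γ)}ᶜ :=
  ⟨(h.countable_exceptionalHodgeLocus hcov P).mono (D.setOf_exists_nonGeneric_subHodgeStructure_subset_exceptionalHodgeLocus_exteriorPower d hP),
    (h.dense_compl_exceptionalHodgeLocus hcov P).mono
      (compl_subset_compl.2 (D.setOf_exists_nonGeneric_subHodgeStructure_subset_exceptionalHodgeLocus_exteriorPower d hP))⟩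

end Charted

/-! ## §3 Lines: generic rank-one sub-Hodge structures at Hodge-generic points -/

section Line

variable {s : S} {u₀ : D.VZ.fiber s} {p : ℤ}

/-- **All flat translates of the line `ℚ · u₀` are sub-Hodge structures iff `u₀` is a GENERIC class of type `(p,p)`** (`2p = k`, `u₀ ≠ 0` integral).
[cite: CattaniDeligneKaplan1995, proof of Cor. 1.4 (p. 486) and Cor. 1.3 (p. 484)] -/
theorem forall_exists_subHodgeStructure_translate_line_iff_isHodgeAlong_univ (hu₀ : u₀ ≠ 0) (hpk : p + p = k) :
    (∀ (t : S) (γ : Path.Homotopic.Quotient s t), ∃ W : SubHodgeStructure (D.hodge t), W.toSubmodule = (ℚ ∙ D.toRat s u₀).map (D.V.transport γ)) ↔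
      D.IsHodgeAlong p u₀ univ := by
  haveI : ∀ s : S, Module.Finite ℚ (D.V.fiber s) := fun s => D.finite_fiber s
  rw [isHodgeAlong_univ_iff_forall_quotient]
  exact forall_congr' fun t => forall_congr' fun γ => D.exists_subHodgeStructure_translate_line_iff_isHodgeAt γ hu₀ hpk

/-- **AT A HODGE-GENERIC POINT EVERY RANK-ONE SUB-HODGE STRUCTURE `ℚ · u₀ ⊆ V_s` IS GENERIC**: all its flat translates along all paths are sub-Hodge
structures. [cite: VoisinHodgeII2003, §5.3.3] [cite: GreenGriffithsKerr2012, Ch. III (III.2)] [cite: CattaniDeligneKaplan1995, proof of Cor. 1.4 (p. 486)] -/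
theorem forall_exists_subHodgeStructure_translate_line_of_mem_hodgeGenericLocus (hs : s ∈ D.hodgeGenericLocus) (hu₀ : u₀ ≠ 0) (hpk : p + p = k)
    (hU : ∃ W : SubHodgeStructure (D.hodge s), W.toSubmodule = ℚ ∙ D.toRat s u₀) (t : S) (γ : Path.Homotopic.Quotient s t) :
    ∃ W : SubHodgeStructure (D.hodge t), W.toSubmodule = (ℚ ∙ D.toRat s u₀).map (D.V.transport γ) := by
  haveI : ∀ s : S, Module.Finite ℚ (D.V.fiber s) := fun s => D.finite_fiber s
  exact (D.forall_exists_subHodgeStructure_translate_line_iff_isHodgeAlong_univ hu₀ hpk).2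
    (isHodgeAlong_univ_of_mem_hodgeGenericLocus_self hs hpk ((D.exists_subHodgeStructure_line_iff_isHodgeAt s hu₀ hpk).1 hU)) t γ

/-- **THE POINTS CARRYING A NON-GENERIC LINE SUB-HODGE STRUCTURE ARE EXACTLY THE EXCEPTIONAL HODGE LOCUS OF LEVEL `p`** (`2p = k`).
[cite: CattaniDeligneKaplan1995, Cor. 1.3 (p. 484) and proof of Cor. 1.4 (p. 486)] [cite: VoisinHodgeII2003, §5.3.1] -/
theorem setOf_exists_nonGeneric_line_eq_exceptionalHodgeLocus (hpk : p + p = k) :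
    {s : S | ∃ u₀ : D.VZ.fiber s, u₀ ≠ 0 ∧ (∃ W : SubHodgeStructure (D.hodge s), W.toSubmodule = ℚ ∙ D.toRat s u₀) ∧
        ∃ (t : S) (γ : Path.Homotopic.Quotient s t), ¬ ∃ W : SubHodgeStructure (D.hodge t), W.toSubmodule = (ℚ ∙ D.toRat s u₀).map (D.V.transport γ)} =
      D.exceptionalHodgeLocus p := by
  haveI : ∀ s : S, Module.Finite ℚ (D.V.fiber s) := fun s => D.finite_fiber s
  ext s
  constructor
  · rintro ⟨u₀, hu₀, hU, t, γ, hnot⟩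
    exact ⟨u₀, (D.exists_subHodgeStructure_line_iff_isHodgeAt s hu₀ hpk).1 hU,
      fun hgen => hnot ((D.forall_exists_subHodgeStructure_translate_line_iff_isHodgeAlong_univ hu₀ hpk).2 hgen t γ)⟩
  · rintro ⟨u, hu, hnot⟩
    have hu0 : u ≠ 0 := by
      rintro rfl
      exact hnot (D.isHodgeAlong_zero p s univ)
    refine ⟨u, hu0, (D.exists_subHodgeStructure_line_iff_isHodgeAt s hu0 hpk).2 hu, ?_⟩
    by_contra hall
    refine hnot ((D.forall_exists_subHodgeStructure_translate_line_iff_isHodgeAlong_univ hu0 hpk).1 fun t γ => ?_)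
    by_contra h'
    exact hall ⟨t, γ, h'⟩

/-- Hodge-generic points carry no non-generic line sub-Hodge structure (`2p = k`). [cite: VoisinHodgeII2003, §5.3.3] [cite: GreenGriffithsKerr2012, Ch. III (III.2)] -/
theorem hodgeGenericLocus_subset_compl_setOf_exists_nonGeneric_line (hpk : p + p = k) :
    D.hodgeGenericLocus ⊆ {s : S | ∃ u₀ : D.VZ.fiber s, u₀ ≠ 0 ∧ (∃ W : SubHodgeStructure (D.hodge s), W.toSubmodule = ℚ ∙ D.toRat s u₀) ∧
        ∃ (t : S) (γ : Path.Homotopic.Quotient s t), ¬ ∃ W : SubHodgeStructure (D.hodge t), W.toSubmodule = (ℚ ∙ D.toRat s u₀).map (D.V.transport γ)}ᶜ := by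
  rw [D.setOf_exists_nonGeneric_line_eq_exceptionalHodgeLocus hpk]
  exact fun _ hs => hodgeGenericLocus_subset_compl_exceptionalHodgeLocus_self hpk hs

end Line

end Motives.VHSData

end Literature.AlgebraicGeometry

end
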